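import Summits.QuantumFields.YangMills.Theorems.SlowBitWindowPersistenceChain
import HarnessLib

/-!
# Disjoint slice events cannot outweigh the partition function (D-0145 LINE g12-A, support for ⟨stmt-QuantumFields-23956⟩)

For a finite family of pairwise disjoint measurable slice-`0` events `A_k` on the `2L`-ring,
`Σ_k insTrace L β 𝟙_{A_k} 0 ≤ Z_phys(L, β, 2L)`; in particular for the annuli `{|polDist − kδ| ≤ β^{-γc}}`, `k = 1..K`,
`δ > 2β^{-γc}` — this is the stub `stub_annuli_sum` of the planner's skeleton `bc/g12-A/X1_birth.lean` for the crux
`ToronSmallBall.ToronCoreRaritySubQuartic` (line «paired covariant sheet translates», memo PLAN-X1-v2-gauss.md), now a theorem.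
No summit is proved.
-/

open MeasureTheory Filter Topology Real Function
open scoped Matrix ComplexConjugate BigOperators
open Literature.MathematicalPhysics.QuantumLattice
open Literature.MathematicalPhysics.QuantumFieldTheory hiding SU2
open Summit.QuantumFields.YangMills.Theorems

namespace Summit.QuantumFields.YangMills.Theorems.FemtoTransferGap.TT

open Summit.QuantumFields.YangMills.Theorems.FemtoTransferGap
open Summit.QuantumFields.YangMills.Theorems.FemtoTransferGap.FlatSheet

variable {L : ℕ} [NeZero L]

/-- The closed chain integrates to `Z_phys(L, β, 2L)` (definitional: `physTrace L β (2L) = physTraceSucc L β (2L-1)`). [cite: MontvayMunster1994, (3.145)] -/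
theorem integral_chain_eq_physTrace (β : ℝ) :
    ∫ Us : Fin (2 * L - 1 + 1) → GaugeConfig 3 L SU2,
        (∏ i : Fin (2 * L - 1), transferKernel su2Rep β (Us i.castSucc) (Us i.succ)) *
          physAvg (transferKernel su2Rep β (Us (Fin.last (2 * L - 1)))) (Us 0)
        ∂(Measure.pi fun _ : Fin (2 * L - 1 + 1) => configMeasure SU2 L) = physTrace L β (2 * L) := by
  rfl

/-- ★ **Disjoint slice events cannot outweigh `Z`**: for pairwise disjoint measurable `A_k` (`k ∈ s`) and `β ≥ 0`,
`Σ_{k ∈ s} insTrace L β 𝟙_{A_k} 0 ≤ Z_phys(L, β, 2L)`. [folklore] -/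
theorem sum_insTrace_indicator_zero_le_physTrace {β : ℝ} (hβ : 0 ≤ β) {ι : Type*} (s : Finset ι)
    (A : ι → Set (GaugeConfig 3 L SU2)) (hA : ∀ k ∈ s, MeasurableSet (A k))
    (hdisj : ∀ k ∈ s, ∀ k' ∈ s, k ≠ k' → Disjoint (A k) (A k')) :
    ∑ k ∈ s, insTrace L β ((A k).indicator fun _ => (1 : ℝ)) 0 ≤ physTrace L β (2 * L) := by
  classical
  have hm := measurable_chain (L := L) β
  set C : ℝ := (Real.exp (2 * β) ^ Fintype.card (Edge 3 L)) ^ (2 * L - 1) * Real.exp (2 * β) ^ Fintype.card (Edge 3 L) with hC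
  -- integrability of `chain · 𝟙_S(U_0)` for measurable `S` (pattern of `insTrace_indicator_zero_mono`)
  have hint : ∀ {S : Set (GaugeConfig 3 L SU2)}, MeasurableSet S → Integrable (fun Us : Fin (2 * L - 1 + 1) → GaugeConfig 3 L SU2 =>
      (∏ i : Fin (2 * L - 1), transferKernel su2Rep β (Us i.castSucc) (Us i.succ)) *
        physAvg (transferKernel su2Rep β (Us (Fin.last (2 * L - 1)))) (Us 0) * S.indicator (fun _ => (1 : ℝ)) (Us 0))
      (Measure.pi fun _ : Fin (2 * L - 1 + 1) => configMeasure SU2 L) := fun {S} hS => by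
    refine integrable_of_measurable_abs_le _ (hm.mul ((measurable_const.indicator hS).comp (measurable_pi_apply 0))) (C := C) fun Us => ?_
    have hind : |S.indicator (fun _ => (1 : ℝ)) (Us 0)| ≤ 1 := by
      by_cases hU : Us 0 ∈ S
      · rw [Set.indicator_of_mem hU, abs_one]
      · rw [Set.indicator_of_notMem hU, abs_zero]; exact zero_le_one
    calc |(∏ i : Fin (2 * L - 1), transferKernel su2Rep β (Us i.castSucc) (Us i.succ)) *
          physAvg (transferKernel su2Rep β (Us (Fin.last (2 * L - 1)))) (Us 0) * S.indicator (fun _ => (1 : ℝ)) (Us 0)|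
        = |(∏ i : Fin (2 * L - 1), transferKernel su2Rep β (Us i.castSucc) (Us i.succ)) *
          physAvg (transferKernel su2Rep β (Us (Fin.last (2 * L - 1)))) (Us 0)| * |S.indicator (fun _ => (1 : ℝ)) (Us 0)| := abs_mul _ _
      _ ≤ C * 1 := mul_le_mul (abs_chain_le hβ Us) hind (abs_nonneg _) (by positivity)
      _ = C := mul_one _
  -- integrability of the bare chain
  have hint1 : Integrable (fun Us : Fin (2 * L - 1 + 1) → GaugeConfig 3 L SU2 =>
      (∏ i : Fin (2 * L - 1), transferKernel su2Rep β (Us i.castSucc) (Us i.succ)) *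
        physAvg (transferKernel su2Rep β (Us (Fin.last (2 * L - 1)))) (Us 0))
      (Measure.pi fun _ : Fin (2 * L - 1 + 1) => configMeasure SU2 L) := by
    have h := hint MeasurableSet.univ
    simpa only [Set.indicator_univ, mul_one] using h
  -- pointwise: at most one indicator is on
  have hpt : ∀ U : GaugeConfig 3 L SU2, ∑ k ∈ s, (A k).indicator (fun _ => (1 : ℝ)) U ≤ 1 := by
    intro U
    by_cases h : ∃ k ∈ s, U ∈ A k
    · obtain ⟨k₀, hk₀, hU⟩ := h
      rw [Finset.sum_eq_single_of_mem k₀ hk₀ (fun k hk hne => ?_)]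
      · rw [Set.indicator_of_mem hU]
      · exact Set.indicator_of_notMem (fun hU' => (hdisj k hk k₀ hk₀ hne).le_bot ⟨hU', hU⟩) _
    · push Not at h
      rw [Finset.sum_eq_zero (fun k hk => Set.indicator_of_notMem (h k hk) _)]
      exact zero_le_one
  -- sum of integrals = integral of the sum ≤ integral of the chain = Z
  simp_rw [insTrace_indicator_zero]
  rw [← integral_finsetSum s (fun k hk => hint (hA k hk)), ← integral_chain_eq_physTrace β]
  refine integral_mono (integrable_finsetSum s fun k hk => hint (hA k hk)) hint1 fun Us => ?_
  have h0 := chain_nonneg β Us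
  rw [← Finset.mul_sum]
  calc _ ≤ (∏ i : Fin (2 * L - 1), transferKernel su2Rep β (Us i.castSucc) (Us i.succ)) *
        physAvg (transferKernel su2Rep β (Us (Fin.last (2 * L - 1)))) (Us 0) * 1 := mul_le_mul_of_nonneg_left (hpt (Us 0)) h0
    _ = _ := mul_one _

/-- ★ **The annuli sum** (stub `stub_annuli_sum` of the ⟨23956⟩ skeleton, verbatim up to unfolding `w`/`ann`): for `β ≥ 1`, `δ > 2β^{-γc}`,
`Σ_{k=1}^{K} insTrace L β 𝟙{|polDist − kδ| ≤ β^{-γc}} 0 ≤ Z_phys(L, β, 2L)`. [folklore] -/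
theorem sum_insTrace_annuli_le_physTrace (β : ℝ) (hβ : 1 ≤ β) (γc δ : ℝ) (hδ : 2 * β ^ (-γc) < δ) (K : ℕ) :
    ∑ k ∈ Finset.Icc 1 K, insTrace L β (Set.indicator {U : GaugeConfig 3 L SU2 | |polDist U - k * δ| ≤ β ^ (-γc)} fun _ => (1 : ℝ)) 0 ≤
      physTrace L β (2 * L) := by
  have hβ0 : 0 ≤ β := by linarith
  have hρ : 0 < β ^ (-γc) := Real.rpow_pos_of_pos (by linarith) _
  have hδ0 : 0 < δ := by linarith
  refine sum_insTrace_indicator_zero_le_physTrace hβ0 (Finset.Icc 1 K)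
    (fun k : ℕ => {U : GaugeConfig 3 L SU2 | |polDist U - k * δ| ≤ β ^ (-γc)}) (fun k _ => ?_) (fun k _ k' _ hne => ?_)
  · exact measurableSet_le ((isPhys_polDist.measurable.sub measurable_const).abs) measurable_const
  · rw [Set.disjoint_left]
    intro U hU hU'
    simp only [Set.mem_setOf_eq] at hU hU'
    have hkk : |((k : ℝ) - k') * δ| ≤ 2 * β ^ (-γc) := by
      have : ((k : ℝ) - k') * δ = (polDist U - k' * δ) - (polDist U - k * δ) := by ring
      rw [this]
      exact (abs_sub _ _).trans (by linarith)
    have hlt : |((k : ℝ) - k')| * δ < δ := by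
      rw [← abs_of_pos hδ0, ← abs_mul, abs_of_pos hδ0]; linarith
    have h1 : |((k : ℝ) - k')| < 1 := by
      by_contra hc; push Not at hc; nlinarith
    have hne' : (k : ℤ) ≠ k' := by exact_mod_cast hne
    have hge : (1 : ℝ) ≤ |((k : ℝ) - k')| := by
      have : (1 : ℤ) ≤ |(k : ℤ) - k'| := Int.one_le_abs (sub_ne_zero.2 hne')
      have h' : ((1 : ℤ) : ℝ) ≤ ((|(k : ℤ) - k'| : ℤ) : ℝ) := by exact_mod_cast this
      simpa [Int.cast_abs, Int.cast_sub] using h'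
    linarith

end Summit.QuantumFields.YangMills.Theorems.FemtoTransferGap.TT
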